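import Literature.MathematicalPhysics.QuantumLattice.Imbrie2016.AdmissibleVolume

/-!
# Imbrie (2016), Assumption LLA: the single-site block (n = 1), kernel-checked end to end

CITATION HEADER (lean-in-tree rule 2026-08-18). J. Z. Imbrie, *On many-body localization for quantum spin chains*,
J. Stat. Phys. **163** (2016) 998–1048, doi 10.1007/s10955-016-1508-x, arXiv:1403.7837 [ImbrieJSP2016], eq. (1.1) (model with
+ boundary condition), p. 1000 (admissible laws: densities ≤ ρ₀ on [-1,1]), eq. (1.3) (Assumption LLA(ν, C)).

WHAT IS PROVED (audit cell `pub-imbrie`, LLA.md J8(c) / WE-FINAL class (c) "monomer"; an audit lemma, NOT a statement of the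
paper; LLA itself is NOT asserted). For a ONE-SITE box the Hamiltonian (1.1) of `LLA.lean` is the real symmetric 2×2 matrix
`[[h_eff, γΓ₀], [γΓ₀, -h_eff]]` with `h_eff = h₀ + J₀ + J₁` (both bonds of the box are boundary bonds, i.e. extra fields under the
+ boundary condition):
* `diagEnergy_one`, `H_one_apply`, `H_one_mul_self` (`H² = (h_eff² + γ²Γ₀²)·1`), `trace_H_one` (`tr H = 0`);
* `eigs_one_sq` (every eigenvalue satisfies `λ² = h_eff² + γ²Γ₀²`), `eigs_one_sum` (`Σ λ = 0`), hence
  `two_mul_abs_heff_lt_of_smallGap`: the small-gap event `SmallGap γ δ` (two distinct eigen-indices closer than `δ`) forces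
  `2|h_eff| < δ` — for EVERY `γ` and every transverse factor `Γ₀` (the gap is `2√(h_eff² + γ²Γ₀²) ≥ 2|h_eff|`);
* `volume_slab_one_le`: `Leb{(h, Γ, J) ∈ [-1,1]⁴ : |h₀ + J₀ + J₁| < δ/2} ≤ 8δ` (Fubini: an `h₀`-interval of length `δ` over `[-1,1]³`);
* `boxMeasure_smallGap_one_le`: for every family of admissible laws (densities ≤ ρ₀), every position `a`, every `γ` and
  every `δ ≥ 0`:  `P(min-gap of the 1-site box < δ) ≤ ρ₀⁴ · 8δ`, via `AdmissibleVolume.boxMeasure_smallGap_le_of_volume`;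
  `lla_clause_one`: the same in the exact shape of the `n = 1` clause of `LLA L γ 1 (8ρ₀⁴)`.
MEANING. An instance of the typed LLA inequality checked by the kernel from the laws to the spectrum (statement `LLA.lean` +
domination `AdmissibleVolume.lean` + this file) which is UNIFORM IN `γ` and LINEAR IN `δ`; the in-model laws already in the tree
are `ZeroCoupling.LLA_zero_coupling` (`γ = 0`, all `n`) and the Weyl window `WeylWindow.boxMeasure_smallGap_le`
(`P ≤ ρ₀ 4ⁿ (δ + 2|γ| n)`, all `n`, not `O(δ)` at fixed `γ ≠ 0`).  It is mathematically trivial (row "monomer" of the cell's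
dilute ladder, constant `ρ₀δ` on paper — the `8ρ₀⁴` here is the cruder cube bookkeeping) and says nothing about `n ≥ 2`.
LLA remains an OPEN, UNPROVED hypothesis of [ImbrieJSP2016, Thm 1.1].  No `sorry`, no new axioms.
-/

noncomputable section

namespace Literature.MathematicalPhysics.QuantumLattice.Imbrie2016

open _root_.MeasureTheory Set

/-! ### The 2×2 algebra of the one-site box -/

section MonomerAlgebra

/-- [cite: ImbrieJSP2016, eq. (1.1)] effective field of the single site: `h₀ + J₀ + J₁` (bond 0 couples the boundary spin
`S^z_{-1} = +1` to site 0, bond 1 couples site 0 to the boundary spin `S^z_1 = +1`). -/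
def heff (p : Params 1) : ℝ := p.h 0 + p.J 0 + p.J 1

/-- [cite: ImbrieJSP2016, eq. (1.1)] the spin `σ₀ = ±1` of the single site. -/
def s1 (σ : Cfg 1) : ℝ := if σ 0 then 1 else -1

/-- [cite: ImbrieJSP2016, eq. (1.1)] the configuration "up". -/
def up : Cfg 1 := fun _ => true

/-- [cite: ImbrieJSP2016, eq. (1.1)] the configuration "down". -/
def dn : Cfg 1 := fun _ => false

/-- `up ≠ dn`. [folklore] -/
theorem up_ne_dn : up ≠ dn := by
  intro h
  have := congrFun h 0
  simp [up, dn] at this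

/-- a one-site configuration is up or down. [folklore] -/
theorem cfg_one_eq (σ : Cfg 1) : σ = up ∨ σ = dn := by
  rcases Bool.eq_false_or_eq_true (σ 0) with h | h
  · left
    funext i
    rw [Fin.eq_zero i, h]
    rfl
  · right
    funext i
    rw [Fin.eq_zero i, h]
    rfl

/-- `Finset.univ` of the one-site configurations is `{up, dn}`. [folklore] -/
theorem univ_cfg_one : (Finset.univ : Finset (Cfg 1)) = {up, dn} := by
  ext σ
  simp only [Finset.mem_univ, Finset.mem_insert, Finset.mem_singleton, true_iff]
  exact cfg_one_eq σ

/-- sums over one-site configurations. [folklore] -/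
theorem sum_cfg_one (f : Cfg 1 → ℝ) : ∑ σ, f σ = f up + f dn := by
  rw [univ_cfg_one, Finset.sum_pair up_ne_dn]

/-- the spin of `up` is `+1`. [folklore] -/
@[simp] theorem s1_up : s1 up = 1 := by simp [s1, up]

/-- the spin of `dn` is `-1`. [folklore] -/
@[simp] theorem s1_dn : s1 dn = -1 := by simp [s1, dn]

/-- `σ₀² = 1`. [folklore] -/
theorem s1_mul_self (σ : Cfg 1) : s1 σ * s1 σ = 1 := by
  unfold s1; split_ifs <;> norm_num

/-- [cite: ImbrieJSP2016, eq. (1.1)] the `S^z` factor of site 0 is the spin `σ₀`. -/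
theorem szZ_one_zero (σ : Cfg 1) : szZ σ 0 = s1 σ := by
  unfold szZ s1
  simp

/-- [cite: ImbrieJSP2016, eq. (1.1)] the `S^z` factor of the left boundary site is `+1`. -/
theorem szZ_one_neg_one (σ : Cfg 1) : szZ σ (-1) = 1 := by
  unfold szZ
  simp

/-- [cite: ImbrieJSP2016, eq. (1.1)] the `S^z` factor of the right boundary site is `+1`. -/
theorem szZ_one_one (σ : Cfg 1) : szZ σ 1 = 1 := by
  unfold szZ
  simp

/-- [cite: ImbrieJSP2016, eq. (1.1)] diagonal energy of the one-site box: `(h₀ + J₀ + J₁) σ₀`. -/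
theorem diagEnergy_one (p : Params 1) (σ : Cfg 1) : diagEnergy p σ = heff p * s1 σ := by
  simp only [diagEnergy, Fin.sum_univ_succ, Fin.sum_univ_zero, heff]
  simp [szZ_one_zero, szZ_one_neg_one, szZ_one_one]
  ring

/-- [cite: ImbrieJSP2016, eq. (1.1)] on one site, "σ and τ differ by the flip at 0" means `σ₀ ≠ τ₀`. -/
theorem flipAt_one_iff (σ τ : Cfg 1) : FlipAt σ τ 0 ↔ σ 0 ≠ τ 0 := by
  unfold FlipAt
  constructor
  · rintro ⟨h, -⟩
    exact h
  · intro h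
    exact ⟨h, fun j hj => absurd (Fin.eq_zero j) hj⟩

/-- one-site configurations are equal iff their single spins are. [folklore] -/
theorem cfg_one_eq_iff (σ τ : Cfg 1) : σ = τ ↔ σ 0 = τ 0 := by
  constructor
  · rintro rfl
    rfl
  · intro h
    funext i
    rw [Fin.eq_zero i, h]

/-- [cite: ImbrieJSP2016, eq. (1.1)] off-diagonal part of the one-site box: `γΓ₀` between the two configurations, `0` on the
diagonal. -/
theorem offDiag_one (γ : ℝ) (p : Params 1) (σ τ : Cfg 1) :
    offDiag γ p σ τ = if σ = τ then 0 else γ * p.Γ 0 := by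
  simp only [offDiag, Fin.sum_univ_one]
  by_cases h : σ = τ
  · rw [if_pos h, if_neg]
    rw [flipAt_one_iff, (cfg_one_eq_iff σ τ).1 h]
    exact fun hne => hne rfl
  · rw [if_neg h, if_pos]
    rw [flipAt_one_iff]
    exact fun he => h ((cfg_one_eq_iff σ τ).2 he)

/-- [cite: ImbrieJSP2016, eq. (1.1)] the entries of the one-site Hamiltonian `[[h_eff, γΓ₀], [γΓ₀, -h_eff]]`. -/
theorem H_one_apply (γ : ℝ) (p : Params 1) (σ τ : Cfg 1) :
    H γ p σ τ = if σ = τ then heff p * s1 σ else γ * p.Γ 0 := by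
  simp only [H, Matrix.add_apply, Matrix.diagonal_apply, Matrix.of_apply, diagEnergy_one, offDiag_one]
  split_ifs <;> simp

/-- [cite: ImbrieJSP2016, eq. (1.1)] `H² = (h_eff² + γ²Γ₀²) · 1` for the one-site box. -/
theorem H_one_mul_self (γ : ℝ) (p : Params 1) :
    H γ p * H γ p = (heff p ^ 2 + (γ * p.Γ 0) ^ 2) • (1 : Matrix (Cfg 1) (Cfg 1) ℝ) := by
  ext σ τ
  rw [Matrix.mul_apply, sum_cfg_one, Matrix.smul_apply, Matrix.one_apply]
  simp only [H_one_apply, smul_eq_mul]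
  rcases cfg_one_eq σ with rfl | rfl <;> rcases cfg_one_eq τ with rfl | rfl <;>
    simp [up_ne_dn, up_ne_dn.symm] <;> ring

/-- [cite: ImbrieJSP2016, eq. (1.1)] the one-site Hamiltonian is traceless. -/
theorem trace_H_one (γ : ℝ) (p : Params 1) : (H γ p).trace = 0 := by
  rw [Matrix.trace, sum_cfg_one]
  simp [Matrix.diag, H_one_apply]

/-- [cite: ImbrieJSP2016, eq. (1.1)] every eigenvalue of the one-site box satisfies `λ² = h_eff² + γ²Γ₀²`. -/
theorem eigs_one_sq (γ : ℝ) (p : Params 1) (α : Cfg 1) :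
    eigs γ p α ^ 2 = heff p ^ 2 + (γ * p.Γ 0) ^ 2 := by
  have hA := H_isHermitian γ p
  have hv := hA.mulVec_eigenvectorBasis α
  have hne : (⇑(hA.eigenvectorBasis α) : Cfg 1 → ℝ) ≠ 0 :=
    (WithLp.ofLp_eq_zero 2).ne.2 (hA.eigenvectorBasis.orthonormal.ne_zero α)
  have h2 : (H γ p * H γ p).mulVec ⇑(hA.eigenvectorBasis α) =
      (hA.eigenvalues α ^ 2) • ⇑(hA.eigenvectorBasis α) := by
    rw [← Matrix.mulVec_mulVec, hv, Matrix.mulVec_smul, hv, smul_smul, sq]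
  rw [H_one_mul_self, Matrix.smul_mulVec, Matrix.one_mulVec] at h2
  have h3 : (heff p ^ 2 + (γ * p.Γ 0) ^ 2 - hA.eigenvalues α ^ 2) • (⇑(hA.eigenvectorBasis α) : Cfg 1 → ℝ) = 0 := by
    rw [sub_smul, h2, sub_self]
  rcases smul_eq_zero.1 h3 with h | h
  · have : hA.eigenvalues α ^ 2 = heff p ^ 2 + (γ * p.Γ 0) ^ 2 := by linarith
    exact this
  · exact absurd h hne

/-- [cite: ImbrieJSP2016, eq. (1.1)] the two eigenvalues of the one-site box sum to zero. -/
theorem eigs_one_sum (γ : ℝ) (p : Params 1) : ∑ α, eigs γ p α = 0 := by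
  have h := (H_isHermitian γ p).trace_eq_sum_eigenvalues
  rw [trace_H_one] at h
  simp only [RCLike.ofReal_real_eq_id, id_eq] at h
  exact h.symm

/-- [cite: ImbrieJSP2016, eq. (1.1) and (1.3)] **on one site the small-gap event forces a small effective field**: if two
distinct eigen-indices are closer than `δ` then `2|h₀ + J₀ + J₁| < δ`, for every `γ` and every `Γ₀`
(gap `= 2√(h_eff² + γ²Γ₀²) ≥ 2|h_eff|`). -/
theorem two_mul_abs_heff_lt_of_smallGap (γ : ℝ) (p : Params 1) {δ : ℝ} (h : SmallGap γ δ p) :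
    2 * |heff p| < δ := by
  obtain ⟨α, β, hne, hlt⟩ := h
  have hsum : eigs γ p α + eigs γ p β = 0 := by
    have hs := eigs_one_sum γ p
    rw [sum_cfg_one] at hs
    rcases cfg_one_eq α with rfl | rfl <;> rcases cfg_one_eq β with rfl | rfl
    · exact absurd rfl hne
    · exact hs
    · rw [add_comm]; exact hs
    · exact absurd rfl hne
  have hβ : eigs γ p β = -eigs γ p α := by linarith
  rw [hβ, sub_neg_eq_add, ← two_mul, abs_mul, abs_two] at hlt
  have hle : |heff p| ≤ |eigs γ p α| := by
    rw [← sq_le_sq]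
    rw [eigs_one_sq]
    nlinarith [sq_nonneg (γ * p.Γ 0)]
  linarith

end MonomerAlgebra

/-! ### The law: Fubini on the coupling cube and the admissible-law bridge -/

section MonomerLaw

/-- [cite: ImbrieJSP2016, eq. (1.3)] in coordinates `t = (h, Γ, J)`: the one-site small-gap event lies in the slab
`|h₀ + J₀ + J₁| < δ/2`. -/
theorem smallGap_one_subset (γ δ : ℝ) :
    {t : (Fin 1 → ℝ) × (Fin 1 → ℝ) × (Fin (1 + 1) → ℝ) | SmallGap γ δ (Params.ofTriple t)} ⊆
      {t | |t.1 0 + t.2.2 0 + t.2.2 1| < δ / 2} := by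
  intro t ht
  have h := two_mul_abs_heff_lt_of_smallGap γ (Params.ofTriple t) ht
  simp only [heff, Params.ofTriple, Set.mem_setOf_eq] at h ⊢
  linarith

/-- the `h₀`-section of the slab is an interval of length `δ`. [folklore] -/
theorem volume_fieldSlab_le (c δ : ℝ) :
    (volume : Measure (Fin 1 → ℝ)) {x | |x 0 + c| < δ / 2} ≤ ENNReal.ofReal δ := by
  rcases le_or_gt δ 0 with hδ | hδ
  · have he : {x : Fin 1 → ℝ | |x 0 + c| < δ / 2} = ∅ := by
      ext x
      simp only [Set.mem_setOf_eq, Set.mem_empty_iff_false, iff_false, not_lt]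
      have := abs_nonneg (x 0 + c)
      linarith
    rw [he, measure_empty]
    exact zero_le
  have hsub : {x : Fin 1 → ℝ | |x 0 + c| < δ / 2} ⊆ Set.univ.pi fun _ : Fin 1 => Set.Ioo (-c - δ / 2) (-c + δ / 2) := by
    intro x hx
    simp only [Set.mem_setOf_eq, abs_lt] at hx
    simp only [Set.mem_univ_pi, Set.mem_Ioo]
    intro i
    rw [Fin.eq_zero i]
    constructor <;> linarith [hx.1, hx.2]
  refine (measure_mono hsub).trans ?_
  rw [volume_pi_pi]
  simp only [Real.volume_Ioo, Finset.prod_const, Finset.card_univ, Fintype.card_fin, pow_one]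
  apply le_of_eq
  congr 1
  ring

/-- [cite: ImbrieJSP2016, eq. (1.3)] **Fubini bound**: `Leb{(h, Γ, J) ∈ [-1,1]^1 × [-1,1]^1 × [-1,1]^2 : |h₀ + J₀ + J₁| < δ/2} ≤ 8δ`. -/
theorem volume_slab_one_le (δ : ℝ) (hδ : 0 ≤ δ) :
    ((volume : Measure (Fin 1 → ℝ)).prod
        ((volume : Measure (Fin 1 → ℝ)).prod (volume : Measure (Fin (1 + 1) → ℝ))))
      ({t | |t.1 0 + t.2.2 0 + t.2.2 1| < δ / 2} ∩
        (Set.univ.pi fun _ : Fin 1 => Set.Icc (-1 : ℝ) 1) ×ˢ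
          ((Set.univ.pi fun _ : Fin 1 => Set.Icc (-1 : ℝ) 1) ×ˢ (Set.univ.pi fun _ : Fin (1 + 1) => Set.Icc (-1 : ℝ) 1)))
      ≤ ENNReal.ofReal (8 * δ) := by
  set C1 : Set (Fin 1 → ℝ) := Set.univ.pi fun _ : Fin 1 => Set.Icc (-1 : ℝ) 1 with hC1def
  set C2 : Set (Fin (1 + 1) → ℝ) := Set.univ.pi fun _ : Fin (1 + 1) => Set.Icc (-1 : ℝ) 1 with hC2def
  have hC1 : MeasurableSet C1 := MeasurableSet.univ_pi fun _ => measurableSet_Icc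
  have hC2 : MeasurableSet C2 := MeasurableSet.univ_pi fun _ => measurableSet_Icc
  set s := {t : (Fin 1 → ℝ) × (Fin 1 → ℝ) × (Fin (1 + 1) → ℝ) | |t.1 0 + t.2.2 0 + t.2.2 1| < δ / 2} ∩
    C1 ×ˢ (C1 ×ˢ C2) with hsdef
  have hf : Measurable fun t : (Fin 1 → ℝ) × (Fin 1 → ℝ) × (Fin (1 + 1) → ℝ) => |t.1 0 + t.2.2 0 + t.2.2 1| := by
    fun_prop
  have hs : MeasurableSet s := (measurableSet_lt hf measurable_const).inter (hC1.prod (hC1.prod hC2))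
  rw [Measure.prod_apply_symm hs]
  have hpt : ∀ y : (Fin 1 → ℝ) × (Fin (1 + 1) → ℝ),
      (volume : Measure (Fin 1 → ℝ)) ((fun x => (x, y)) ⁻¹' s) ≤
        (C1 ×ˢ C2).indicator (fun _ => ENNReal.ofReal δ) y := by
    intro y
    by_cases hy : y ∈ C1 ×ˢ C2
    · rw [Set.indicator_of_mem hy]
      refine (measure_mono ?_).trans (volume_fieldSlab_le (y.2 0 + y.2 1) δ)
      intro x hx
      simp only [hsdef, Set.mem_preimage, Set.mem_inter_iff, Set.mem_setOf_eq] at hx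
      simp only [Set.mem_setOf_eq, ← add_assoc]
      exact hx.1
    · rw [Set.indicator_of_notMem hy]
      have he : (fun x => (x, y)) ⁻¹' s = ∅ := by
        ext x
        simp only [Set.mem_preimage, Set.mem_empty_iff_false, iff_false]
        intro hx
        exact hy hx.2.2
      rw [he, measure_empty]
  refine (lintegral_mono hpt).trans ?_
  rw [lintegral_indicator_const (hC1.prod hC2), Measure.prod_prod]
  have hv1 : (volume : Measure (Fin 1 → ℝ)) C1 = ENNReal.ofReal 2 := by
    rw [hC1def, volume_pi_pi]
    simp only [Real.volume_Icc, Finset.prod_const, Finset.card_univ, Fintype.card_fin, pow_one]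
    norm_num
  have hv2 : (volume : Measure (Fin (1 + 1) → ℝ)) C2 = ENNReal.ofReal 2 * ENNReal.ofReal 2 := by
    rw [hC2def, volume_pi_pi]
    simp only [Real.volume_Icc, Finset.prod_const, Finset.card_univ, Fintype.card_fin]
    norm_num [sq]
  rw [hv1, hv2, ← ENNReal.ofReal_mul (by norm_num), ← ENNReal.ofReal_mul (by norm_num), ← ENNReal.ofReal_mul hδ]
  apply le_of_eq
  congr 1
  ring

/-- [cite: ImbrieJSP2016, eq. (1.3) and p. 1000] **the one-site block law, kernel-checked from the laws to the spectrum**: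
for every family of admissible laws (densities `≤ ρ₀` on `[-1,1]`), every position `a`, every coupling `γ` and every `δ ≥ 0`,
`P(min-gap of the one-site box < δ) ≤ ρ₀⁴ · 8δ`.  (Paper constant: `ρ₀δ`, LLA.md J8(c)/WE-FINAL; the cube bookkeeping here
is cruder.)  Audit-cell lemma; LLA for `n ≥ 2` is NOT touched. -/
theorem boxMeasure_smallGap_one_le {L : Laws} {ρ₀ : ℝ} (hL : L.Admissible ρ₀) (hρ : 0 ≤ ρ₀) (a : ℤ) (γ δ : ℝ)
    (hδ : 0 ≤ δ) :
    L.boxMeasure a 1 {t | SmallGap γ δ (Params.ofTriple t)} ≤ ENNReal.ofReal (ρ₀ ^ 4 * (8 * δ)) := by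
  have h := boxMeasure_smallGap_le_of_volume hL hρ a 1 γ δ (8 * δ)
    ((measure_mono (Set.inter_subset_inter_left _ (smallGap_one_subset γ δ))).trans (volume_slab_one_le δ hδ))
  simpa using h

/-- [cite: ImbrieJSP2016, eq. (1.3)] the same bound in the exact shape of the `n = 1` clause of `LLA L γ ν C` with `ν = 1`,
`C = 8ρ₀⁴`: `P ≤ δ^1 · C^1`.  (Only the clause `n = 1`; `LLA` quantifies over all `n` and is NOT asserted.) -/
theorem lla_clause_one {L : Laws} {ρ₀ : ℝ} (hL : L.Admissible ρ₀) (hρ : 0 ≤ ρ₀) (γ : ℝ) (a : ℤ) (δ : ℝ) (hδ : 0 < δ) :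
    L.boxMeasure a 1 {t | SmallGap γ δ (Params.ofTriple t)} ≤
      ENNReal.ofReal (δ ^ (1 : ℝ) * (8 * ρ₀ ^ 4) ^ (1 : ℕ)) := by
  rw [Real.rpow_one, pow_one]
  have h := boxMeasure_smallGap_one_le hL hρ a γ δ hδ.le
  have e : ρ₀ ^ 4 * (8 * δ) = δ * (8 * ρ₀ ^ 4) := by ring
  rwa [e] at h

end MonomerLaw

end Literature.MathematicalPhysics.QuantumLattice.Imbrie2016
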